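import Summits.QuantumFields.BalabanUV.T4Continuum.Support.NE3QbarIterMajorant
import Summits.QuantumFields.BalabanUV.T4Continuum.Support.NE3QuadRemainderLocality
import HarnessLib

/-!
# T⁴ programme, node NE3, route Π (Γ″) · γ4″-CORE (file A′) — THE LINEARISED k-FOLD AVERAGE `dirIter` IS DOMINATED BY THE
# MAJORANT TOWER PLUS THE FRAME FUNCTIONAL TOWER: `‖Y(b)‖ ≤ ω(b)` ⇒
# `‖dirIter L (j+1) W Y (z,κ)‖ ≤ majIter d L (j+1) x ω (z,κ) + frameMaj d L (j+1) x ω z + frameMaj d L (j+1) x ω (z + e_κ)`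

NE3 formalisation swarm `b2b-balaban-t4-ne3-formalise-*`, LEAF PROVER 04 (gen 8), OFFER «γ4″-core» to the Π-C-3γ holder
(`leaf-02-g8`, design addendum D-ne3leaf02g8-1 §4 «ROUTE Γ″», item γ4″ `NE3LinearTowerProfile` — «the one real estimate»; journal
HOME/CLAIMS.log l.24945 ∕ l.25042).  Sequel of file A `NE3QbarIterMajorant` (the double-bar tower `QbarIter ≤ majIter`).

THE POINT.  By this lineage's structure theorem `NE3TangentCovariantTower.dirIter_eq_QbarIter_add_gaugeDir` (leaf-04 g4), in the
multi-level small-field class and for a skew periodic direction `Y`,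
`dirIter L (j+1) W Y = QbarIter L (j+1) W Y + gaugeDir (cavgIter L (j+1) W) (framePotW L (j+1) W Y)`; the accumulated frame generator
obeys `framePotW L (j+1) W Y z = framePotW L j W₁ (Qbar L W Y) z + Fbar L W Y (L^j•z)` and ONE linearised frame is a block average of
transported TREE words, `‖Fbar L W Y y‖ ≤ treeW₀ L ω (L•y) = Σ_x L^{−d} Σ_{b ⊂ Γ_{L•y, x}} ω(b)` (`frameLin`, `norm_dhol_le`).  Hence the
accumulated frames are dominated by the positive FRAME FUNCTIONAL TOWER `frameMaj` (same recursion, with file A's `stepMaj` feeding the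
next level), and `‖gaugeDir V f (z,κ)‖ ≤ ‖f z‖ + ‖f (z+e_κ)‖` at a unitary `V`.  No constant, no currency: the evaluation on the
three-tier weight `σ + β·H + γ·H²` (leaf-02-g8's γ4″) is file B.

CONTENT (all [folklore]; 0 sorry; real-valued DATA defs `treeW₀`, `treeStep`, `frameMaj` → async audit):
* §1 `treeW₀`∕`treeStep` (the tree functional read at a block corner), linearity∕monotonicity∕nonnegativity; `norm_frameLin_le_treeW₀`,
  `norm_Fbar_le_treeStep` under domination;
* §2 `frameMaj` (inner-first recursion of `framePotW` on weights) + its algebra (`frameMaj_add`∕`_smul`∕`_mono`∕`_nonneg`) and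
  **`norm_framePotW_le_frameMaj`** (class `LevelSmall d L j x`): `‖framePotW L (j+1) W Y z‖ ≤ frameMaj d L (j+1) x ω z`;
* §3 **`norm_dirIter_le_majorant`**: unitary `(tower L M (j+1))`-periodic `W`, `0 ≤ x`, `LevelSmall d L j x`, `SmallField W x`, skew
  `(tower L M (j+1))`-periodic `Y` with `‖Y(b)‖ ≤ ω(b)` ⟹
  `‖dirIter L (j+1) W Y z κ‖ ≤ majIter d L (j+1) x ω z κ + frameMaj d L (j+1) x ω z + frameMaj d L (j+1) x ω (z + e κ)`;
* §4 LOCALITY of the functionals (`lsum_congr_of_l1`, `stepMaj_congr_of_l1`, `majIter_congr_of_l1`, `frameMaj_congr_of_l1`: the towers at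
  `z` read the weight only within ℓ¹-distance `NE3QuadRemainderLocality.depRad d L j` of `L^j•z`, the dependency radius of Π-C-3d) and the
  LOCAL-HYPOTHESIS versions `norm_QbarIter_le_majIter_local`, `norm_framePotW_le_frameMaj_local`, **`norm_dirIter_le_majorant_local`**
  (domination `‖Y(b)‖ ≤ ω(b)` asked only on the bonds starting within `depRad d L (j+1)` of `L^{j+1}•z` and of `L^{j+1}•(z + e_κ)`).

HONEST: positive-operator bookkeeping on OUR frame; nothing about minimisers, (Π-REG-γ″), Π-C-3γ″, T-E_w♯ or NE3 is asserted; NE3 NOT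
proved; spine PROVED 0∕9; finite T⁴ rung (B)+1 — NOT infinite volume, NOT mass gap, NOT BetaPertH, NOT Clay.
PLACEMENT: `Summits/QuantumFields/BalabanUV/` (cell rule: our work, not a published statement).
-/

set_option autoImplicit false

open scoped BigOperators Matrix.Norms.L2Operator
open Finset

namespace Summit.QuantumFields.BalabanUV.T4Continuum.NE3DirIterMajorant

open Literature.MathematicalPhysics.QuantumFieldTheory.Balaban1983to89
open B7Prop1Explicit B7Prop2Explicit
open T4AveragingDeficitWall (IsUnitaryCfg IsSkewDir SmallField Ad)
open T4AveragingDeficitWallBoundary (IsPeriodicCfg)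
open AveragingDeficitPeriodicCounting (IsPeriodicDir)
open AveragingDeficitTransport (dhol lnorm norm_dhol_le norm_Ad_of_unitary)
open AveragingDeficitChartCalculus (cavg)
open AveragingDeficitTwoLevelPrep (prop1Radius)
open AveragingDeficitMultiLevelPrep (cavgIter tower LevelSmall prop1Radius_nonneg cavgIter_unitary_small)
open BlockAveragePushDirGauge (gaugeDir)
open BlockAveragePushDirSplit (frameLin)
open NE3TangentCovariantStructure (Qbar Fbar)
open NE3TangentCovariantTower (dirIter QbarIter framePotW step_small framePotW_succ framePotW_zero dirIter_eq_QbarIter_add_gaugeDir)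
open AveragingDeficitSideDeriv (loopWord)
open BlockAverageVaryHolo (nbRad length_loopWord_le)
open NE3QuadRemainderLocality (depRad l1_le_depRad_succ)
open NE3QbarIterMajorant (lsum lsum_nil lsum_cons lsum_add lsum_smul lsum_mono lsum_nonneg lnorm_le_lsum segW loopW treeW' locW segStep locStep
  stepMaj majIter majIter_zero majIter_succ norm_Qbar_le_stepMaj norm_QbarIter_le_majIter stepMaj_add stepMaj_smul stepMaj_mono stepMaj_nonneg)

noncomputable section

variable {d : ℕ} {n : Type*} [Fintype n] [DecidableEq n]

/-! ## §1 The tree functional -/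

/-- The block average of the TREE weights rooted at `q`: `treeW₀ L ω q = Σ_x L^{−d} Σ_{b ⊂ Γ_{q, q+x}} ω(b)` (the positive functional
dominating the linearised frame `frameLin L W Y q`). [folklore] -/
def treeW₀ (L : ℕ) (ω : Site d → Fin d → ℝ) (q : Site d) : ℝ :=
  ∑ r : Fin d → Fin L, ((L : ℝ) ^ d)⁻¹ * lsum ω q (treeWord (boxVec L r))

/-- The tree functional read at the block corner of a coarse site: `treeStep L ω y := treeW₀ L ω (L•y)` (dominates `Fbar L W Y y`). [folklore] -/
def treeStep (L : ℕ) (ω : Site d → Fin d → ℝ) (y : Site d) : ℝ := treeW₀ L ω ((L : ℤ) • y)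

omit [Fintype n] [DecidableEq n] in
/-- `treeW₀` is additive in the weight. [folklore] -/
theorem treeW₀_add (L : ℕ) (ω₁ ω₂ : Site d → Fin d → ℝ) (q : Site d) :
    treeW₀ L (fun y μ => ω₁ y μ + ω₂ y μ) q = treeW₀ L ω₁ q + treeW₀ L ω₂ q := by
  simp only [treeW₀, lsum_add, mul_add, Finset.sum_add_distrib]

omit [Fintype n] [DecidableEq n] in
/-- `treeW₀` is homogeneous in the weight. [folklore] -/
theorem treeW₀_smul (L : ℕ) (c : ℝ) (ω : Site d → Fin d → ℝ) (q : Site d) :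
    treeW₀ L (fun y μ => c * ω y μ) q = c * treeW₀ L ω q := by
  simp only [treeW₀, lsum_smul, Finset.mul_sum]
  exact Finset.sum_congr rfl fun r _ => by ring

omit [Fintype n] [DecidableEq n] in
/-- `treeW₀` is monotone in the weight. [folklore] -/
theorem treeW₀_mono (L : ℕ) {ω₁ ω₂ : Site d → Fin d → ℝ} (h : ∀ (y : Site d) (μ : Fin d), ω₁ y μ ≤ ω₂ y μ) (q : Site d) :
    treeW₀ L ω₁ q ≤ treeW₀ L ω₂ q :=
  Finset.sum_le_sum fun r _ => mul_le_mul_of_nonneg_left (lsum_mono h _ _) (by positivity)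

omit [Fintype n] [DecidableEq n] in
/-- `treeW₀ ω ≥ 0` for `ω ≥ 0`. [folklore] -/
theorem treeW₀_nonneg (L : ℕ) {ω : Site d → Fin d → ℝ} (h : ∀ (y : Site d) (μ : Fin d), 0 ≤ ω y μ) (q : Site d) :
    0 ≤ treeW₀ L ω q :=
  Finset.sum_nonneg fun r _ => mul_nonneg (by positivity) (lsum_nonneg h _ _)

/-- **THE LINEARISED FRAME IS DOMINATED BY THE TREE FUNCTIONAL**: at a unitary `W`, `‖Y(b)‖ ≤ ω(b)` everywhere ⟹
`‖frameLin L W Y q‖ ≤ treeW₀ L ω q` (`frameLin = Σ_x L^{−d}•δ_Y W(Γ_{q,x})`, `norm_dhol_le`, `lnorm ≤ lsum`). [folklore] -/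
theorem norm_frameLin_le_treeW₀ (L : ℕ) {W : Site d → Fin d → (Matrix n n ℂ)ˣ} (hWu : IsUnitaryCfg W)
    {Y : Site d → Fin d → Matrix n n ℂ} {ω : Site d → Fin d → ℝ} (hdom : ∀ (y : Site d) (μ : Fin d), ‖Y y μ‖ ≤ ω y μ)
    (q : Site d) : ‖frameLin L W Y q‖ ≤ treeW₀ L ω q := by
  unfold frameLin treeW₀
  refine (norm_sum_le _ _).trans (Finset.sum_le_sum fun r _ => ?_)
  rw [norm_smul, norm_inv, norm_pow, Real.norm_natCast]
  exact mul_le_mul_of_nonneg_left ((norm_dhol_le hWu Y _ _).trans (lnorm_le_lsum hdom _ _)) (by positivity)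

/-- `‖Fbar L W Y y‖ ≤ treeStep L ω y` under domination, at a unitary `W`. [folklore] -/
theorem norm_Fbar_le_treeStep (L : ℕ) {W : Site d → Fin d → (Matrix n n ℂ)ˣ} (hWu : IsUnitaryCfg W)
    {Y : Site d → Fin d → Matrix n n ℂ} {ω : Site d → Fin d → ℝ} (hdom : ∀ (y : Site d) (μ : Fin d), ‖Y y μ‖ ≤ ω y μ)
    (y : Site d) : ‖Fbar L W Y y‖ ≤ treeStep L ω y :=
  norm_frameLin_le_treeW₀ L hWu hdom _

/-! ## §2 The frame functional tower -/

/-- THE FRAME FUNCTIONAL TOWER (inner-first, the recursion of `framePotW` on weights): `frameMaj d L 0 x ω = 0`,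
`frameMaj d L (j+1) x ω z = frameMaj d L j (prop1Radius d L x) (stepMaj d L x ω) z + treeStep L ω (L^j • z)`. [folklore] -/
def frameMaj (d L : ℕ) : ℕ → ℝ → (Site d → Fin d → ℝ) → Site d → ℝ
  | 0, _, _ => fun _ => 0
  | j + 1, x, ω => fun z => frameMaj d L j (prop1Radius d L x) (stepMaj d L x ω) z + treeStep L ω ((((L ^ j : ℕ) : ℤ)) • z)

omit [Fintype n] [DecidableEq n] in
/-- `frameMaj d L 0 x ω = 0`. [folklore] -/
@[simp] theorem frameMaj_zero (d L : ℕ) (x : ℝ) (ω : Site d → Fin d → ℝ) : frameMaj d L 0 x ω = fun _ => 0 := rfl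

omit [Fintype n] [DecidableEq n] in
/-- `frameMaj d L (j+1) x ω z = frameMaj d L j (prop1Radius d L x) (stepMaj d L x ω) z + treeStep L ω (L^j • z)`. [folklore] -/
theorem frameMaj_succ (d L j : ℕ) (x : ℝ) (ω : Site d → Fin d → ℝ) (z : Site d) :
    frameMaj d L (j + 1) x ω z = frameMaj d L j (prop1Radius d L x) (stepMaj d L x ω) z + treeStep L ω ((((L ^ j : ℕ) : ℤ)) • z) := rfl

omit [Fintype n] [DecidableEq n] in
/-- `frameMaj` is additive in the weight. [folklore] -/
theorem frameMaj_add (d L : ℕ) : ∀ (j : ℕ) (x : ℝ) (ω₁ ω₂ : Site d → Fin d → ℝ) (z : Site d),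
    frameMaj d L j x (fun y μ => ω₁ y μ + ω₂ y μ) z = frameMaj d L j x ω₁ z + frameMaj d L j x ω₂ z
  | 0, _, _, _, _ => by simp
  | j + 1, x, ω₁, ω₂, z => by
      rw [frameMaj_succ, frameMaj_succ, frameMaj_succ, stepMaj_add, frameMaj_add d L j (prop1Radius d L x) _ _ z, treeStep, treeStep,
        treeStep, treeW₀_add]
      ring

omit [Fintype n] [DecidableEq n] in
/-- `frameMaj` is homogeneous in the weight. [folklore] -/
theorem frameMaj_smul (d L : ℕ) : ∀ (j : ℕ) (x c : ℝ) (ω : Site d → Fin d → ℝ) (z : Site d),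
    frameMaj d L j x (fun y μ => c * ω y μ) z = c * frameMaj d L j x ω z
  | 0, _, _, _, _ => by simp
  | j + 1, x, c, ω, z => by
      rw [frameMaj_succ, frameMaj_succ, stepMaj_smul, frameMaj_smul d L j (prop1Radius d L x) c _ z, treeStep, treeStep, treeW₀_smul]
      ring

omit [Fintype n] [DecidableEq n] in
/-- `frameMaj` is monotone in the weight (for `x ≥ 0`). [folklore] -/
theorem frameMaj_mono (d L : ℕ) : ∀ (j : ℕ) {x : ℝ}, 0 ≤ x → ∀ {ω₁ ω₂ : Site d → Fin d → ℝ},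
    (∀ (y : Site d) (μ : Fin d), ω₁ y μ ≤ ω₂ y μ) → ∀ (z : Site d), frameMaj d L j x ω₁ z ≤ frameMaj d L j x ω₂ z
  | 0, _, _, _, _, _, z => le_rfl
  | j + 1, x, hx, ω₁, ω₂, h, z => by
      rw [frameMaj_succ, frameMaj_succ]
      exact add_le_add (frameMaj_mono d L j (prop1Radius_nonneg hx) (stepMaj_mono d L hx h) z) (treeW₀_mono L h _)

omit [Fintype n] [DecidableEq n] in
/-- `frameMaj ω ≥ 0` for `ω ≥ 0`, `x ≥ 0`. [folklore] -/
theorem frameMaj_nonneg (d L : ℕ) : ∀ (j : ℕ) {x : ℝ}, 0 ≤ x → ∀ {ω : Site d → Fin d → ℝ},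
    (∀ (y : Site d) (μ : Fin d), 0 ≤ ω y μ) → ∀ (z : Site d), 0 ≤ frameMaj d L j x ω z
  | 0, _, _, _, _, z => le_rfl
  | j + 1, x, hx, ω, h, z => by
      rw [frameMaj_succ]
      exact add_nonneg (frameMaj_nonneg d L j (prop1Radius_nonneg hx) (stepMaj_nonneg d L hx h) z) (treeW₀_nonneg L h _)

/-- **THE ACCUMULATED FRAMES ARE DOMINATED BY THE FRAME FUNCTIONAL TOWER**: in the multi-level small-field class (unitary `W`,
`0 ≤ x`, `LevelSmall d L j x`, `SmallField W x`), `‖Y(b)‖ ≤ ω(b)` everywhere ⟹ `‖framePotW L (j+1) W Y z‖ ≤ frameMaj d L (j+1) x ω z`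
(induction over `framePotW_succ`, finest level first; the recursive call is fed by file A's `norm_Qbar_le_stepMaj`). [folklore] -/
theorem norm_framePotW_le_frameMaj [Nonempty n] {L : ℕ} (hL : 1 ≤ L) (j : ℕ) :
    ∀ {W : Site d → Fin d → (Matrix n n ℂ)ˣ} {x : ℝ}, IsUnitaryCfg W → 0 ≤ x → LevelSmall d L j x → SmallField W x →
    ∀ {Y : Site d → Fin d → Matrix n n ℂ} {ω : Site d → Fin d → ℝ}, (∀ (y : Site d) (μ : Fin d), ‖Y y μ‖ ≤ ω y μ) →
      ∀ (z : Site d), ‖framePotW L (j + 1) W Y z‖ ≤ frameMaj d L (j + 1) x ω z := by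
  induction j with
  | zero =>
      intro W x hWu hx hsm hWx Y ω hdom z
      rw [zero_add, framePotW_succ, frameMaj_succ]
      simp only [framePotW_zero, frameMaj_zero, zero_add]
      exact norm_Fbar_le_treeStep L hWu hdom _
  | succ j ih =>
      intro W x hWu hx hsm hWx Y ω hdom z
      obtain ⟨h512, hW₁u, hr0, hW₁x⟩ := step_small hL hWu hx hsm.1 hWx
      rw [framePotW_succ, frameMaj_succ]
      exact (norm_add_le _ _).trans (add_le_add
        (ih hW₁u hr0 hsm.2 hW₁x (fun y μ => norm_Qbar_le_stepMaj hL hWu hx h512 hWx hdom y μ) z)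
        (norm_Fbar_le_treeStep L hWu hdom _))

/-! ## §3 `dirIter` is dominated by the majorant tower plus the frame functional tower -/

/-- `‖gaugeDir V f z κ‖ ≤ ‖f z‖ + ‖f (z + e κ)‖` at a unitary `V` (`Ad` is isometric). [folklore] -/
theorem norm_gaugeDir_le {V : Site d → Fin d → (Matrix n n ℂ)ˣ} (hV : IsUnitaryCfg V) (f : Site d → Matrix n n ℂ)
    (z : Site d) (κ : Fin d) : ‖gaugeDir V f z κ‖ ≤ ‖f z‖ + ‖f (z + e κ)‖ := by
  unfold gaugeDir
  refine (norm_sub_le _ _).trans (add_le_add (le_of_eq ?_) le_rfl)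
  exact norm_Ad_of_unitary ((unitaryUnits (Matrix n n ℂ)).inv_mem (hV z κ)) _

/-- **`dirIter` IS DOMINATED BY THE MAJORANT TOWER PLUS THE FRAME FUNCTIONAL TOWER**: in the multi-level small-field class
(unitary `(tower L M (j+1))`-periodic `W`, `0 ≤ x`, `LevelSmall d L j x`, `SmallField W x`) and for a skew `(tower L M (j+1))`-periodic
direction `Y` with `‖Y(b)‖ ≤ ω(b)` on every bond,
`‖dirIter L (j+1) W Y z κ‖ ≤ majIter d L (j+1) x ω z κ + frameMaj d L (j+1) x ω z + frameMaj d L (j+1) x ω (z + e κ)`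
(this lineage's structure theorem `dirIter = QbarIter + gaugeDir (cavgIter W) framePotW`, file A, §2, and `‖gaugeDir V f‖ ≤ ‖f z‖ + ‖f(z+e_κ)‖`
at the unitary `cavgIter L (j+1) W`). [folklore] -/
theorem norm_dirIter_le_majorant [Nonempty n] {L M : ℕ} [NeZero M] (hL : 1 ≤ L) (j : ℕ)
    {W : Site d → Fin d → (Matrix n n ℂ)ˣ} {x : ℝ} (hWu : IsUnitaryCfg W) (hWP : IsPeriodicCfg W ((tower L M (j + 1) : ℕ) : ℤ))
    (hx : 0 ≤ x) (hs : LevelSmall d L j x) (hWx : SmallField W x)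
    {Y : Site d → Fin d → Matrix n n ℂ} (hY : IsSkewDir Y) (hYP : IsPeriodicDir Y ((tower L M (j + 1) : ℕ) : ℤ))
    {ω : Site d → Fin d → ℝ} (hdom : ∀ (y : Site d) (μ : Fin d), ‖Y y μ‖ ≤ ω y μ) (z : Site d) (κ : Fin d) :
    ‖dirIter L (j + 1) W Y z κ‖
      ≤ majIter d L (j + 1) x ω z κ + frameMaj d L (j + 1) x ω z + frameMaj d L (j + 1) x ω (z + e κ) := by
  rw [dirIter_eq_QbarIter_add_gaugeDir (M := M) hL j hWu hWP hx hs hWx hY hYP]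
  have hVu : IsUnitaryCfg (cavgIter L (j + 1) W) := (cavgIter_unitary_small hL j hWu hx hs hWx).1
  have h1 := norm_QbarIter_le_majIter hL j hWu hx hs hWx hdom z κ
  have h2 := norm_gaugeDir_le hVu (framePotW L (j + 1) W Y) z κ
  have h3 := norm_framePotW_le_frameMaj hL j hWu hx hs hWx hdom z
  have h4 := norm_framePotW_le_frameMaj hL j hWu hx hs hWx hdom (z + e κ)
  calc _ ≤ ‖QbarIter L (j + 1) W Y z κ‖ + ‖gaugeDir (cavgIter L (j + 1) W) (framePotW L (j + 1) W Y) z κ‖ := norm_add_le _ _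
    _ ≤ _ := by linarith

/-! ## §4 Locality of the functionals and the local-hypothesis versions -/

omit [Fintype n] [DecidableEq n] in
/-- A word weight reads the weight only on the bonds of the word: if `ω₁ = ω₂` on the bonds starting within ℓ¹-distance `R` of `q` and
`|x − q|₁ + |Γ| ≤ R`, then `lsum ω₁ x Γ = lsum ω₂ x Γ`. [folklore] -/
theorem lsum_congr_of_l1 {ω₁ ω₂ : Site d → Fin d → ℝ} {q : Site d} {R : ℕ}
    (h : ∀ (x : Site d) (μ : Fin d), l1 (x - q) ≤ R → ω₁ x μ = ω₂ x μ) :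
    ∀ (w : List (Letter d)) (x : Site d), l1 (x - q) + w.length ≤ R → lsum ω₁ x w = lsum ω₂ x w
  | [], x, _ => by simp
  | l :: w, x, hx => by
    rw [List.length_cons] at hx
    have hx' : l1 (x + l.vec - q) + w.length ≤ R := by
      have := l1_add_le (x - q) l.vec
      rw [l1_vec, show x - q + l.vec = x + l.vec - q by abel] at this
      omega
    rw [lsum_cons, lsum_cons, lsum_congr_of_l1 h w (x + l.vec) hx']
    congr 1
    split
    · exact h x l.1 (by omega)
    · exact h (x + l.vec) l.1 (by omega)

omit [Fintype n] [DecidableEq n] in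
/-- THE ONE-LEVEL MAJORANT STEP IS LOCAL: `stepMaj d L x ω z κ` reads `ω` only on the bonds starting within ℓ¹-distance `nbRad d L` of `L•z`
(segments of the block, loops `Γ_{c,x} ∪ (−Γ_c)`, trees from `c₊`). [folklore] -/
theorem stepMaj_congr_of_l1 (L : ℕ) (x : ℝ) {ω₁ ω₂ : Site d → Fin d → ℝ} (z : Site d)
    (h : ∀ (y : Site d) (μ : Fin d), l1 (y - (L : ℤ) • z) ≤ nbRad d L → ω₁ y μ = ω₂ y μ) (κ : Fin d) :
    stepMaj d L x ω₁ z κ = stepMaj d L x ω₂ z κ := by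
  have hseg : ∑ r : Fin d → Fin L, ((L : ℝ) ^ d)⁻¹ * lsum ω₁ ((L : ℤ) • z + boxVec L r) (seg κ L)
      = ∑ r : Fin d → Fin L, ((L : ℝ) ^ d)⁻¹ * lsum ω₂ ((L : ℤ) • z + boxVec L r) (seg κ L) :=
    Finset.sum_congr rfl fun r _ => by
      rw [lsum_congr_of_l1 h _ _ (by rw [add_sub_cancel_left, length_seg, Int.natAbs_natCast, nbRad]; have := l1_boxVec_le L r; omega)]
  have hseg0 : lsum ω₁ ((L : ℤ) • z) (seg κ L) = lsum ω₂ ((L : ℤ) • z) (seg κ L) :=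
    lsum_congr_of_l1 h _ _ (by rw [sub_self, length_seg, Int.natAbs_natCast, nbRad]; simp [l1]; omega)
  have hloop : ∑ r : Fin d → Fin L, ((L : ℝ) ^ d)⁻¹ * lsum ω₁ ((L : ℤ) • z) (loopWord L κ (boxVec L r))
      = ∑ r : Fin d → Fin L, ((L : ℝ) ^ d)⁻¹ * lsum ω₂ ((L : ℤ) • z) (loopWord L κ (boxVec L r)) :=
    Finset.sum_congr rfl fun r _ => by
      rw [lsum_congr_of_l1 h _ _ (by
        rw [sub_self]; simp only [l1, Pi.zero_apply, Int.natAbs_zero, Finset.sum_const_zero, zero_add]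
        exact length_loopWord_le L κ r)]
  have htree : ∑ r : Fin d → Fin L, ((L : ℝ) ^ d)⁻¹ * lsum ω₁ ((L : ℤ) • z + (L : ℤ) • e κ) (treeWord (boxVec L r))
      = ∑ r : Fin d → Fin L, ((L : ℝ) ^ d)⁻¹ * lsum ω₂ ((L : ℤ) • z + (L : ℤ) • e κ) (treeWord (boxVec L r)) :=
    Finset.sum_congr rfl fun r _ => by
      rw [lsum_congr_of_l1 h _ _ (by
        rw [add_sub_cancel_left, BlockAverageDbarLinNorms.l1_natCast_smul_e, length_treeWord, nbRad]; have := l1_boxVec_le L r; omega)]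
  simp only [stepMaj, segStep, locStep, segW, locW, loopW, treeW']
  rw [hseg, hseg0, hloop, htree]

omit [Fintype n] [DecidableEq n] in
/-- The tree functional is local: `treeStep L ω y` reads `ω` only within ℓ¹-distance `nbRad d L` of `L•y`. [folklore] -/
theorem treeStep_congr_of_l1 (L : ℕ) {ω₁ ω₂ : Site d → Fin d → ℝ} (y : Site d)
    (h : ∀ (y' : Site d) (μ : Fin d), l1 (y' - (L : ℤ) • y) ≤ nbRad d L → ω₁ y' μ = ω₂ y' μ) : treeStep L ω₁ y = treeStep L ω₂ y := by
  have htree : ∀ r : Fin d → Fin L, lsum ω₁ ((L : ℤ) • y) (treeWord (boxVec L r)) = lsum ω₂ ((L : ℤ) • y) (treeWord (boxVec L r)) :=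
    fun r => lsum_congr_of_l1 h _ _ (by
      rw [sub_self, length_treeWord, nbRad]; have := l1_boxVec_le L r
      have h0 : l1 (0 : Site d) = 0 := by simp [l1]
      rw [h0]; omega)
  simp only [treeStep, treeW₀]
  exact Finset.sum_congr rfl fun r _ => by rw [htree r]

omit [Fintype n] [DecidableEq n] in
/-- **THE MAJORANT TOWER IS LOCAL**: `majIter d L j x ω z κ` reads `ω` only on the bonds starting within ℓ¹-distance `depRad d L j` of `L^j•z`
(the dependency radius of Π-C-3d's `dirIter_congr_of_l1`). [folklore] -/
theorem majIter_congr_of_l1 (d L : ℕ) : ∀ (j : ℕ) (x : ℝ) {ω₁ ω₂ : Site d → Fin d → ℝ} (z : Site d),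
    (∀ (y : Site d) (μ : Fin d), l1 (y - ((L : ℤ) ^ j) • z) ≤ depRad d L j → ω₁ y μ = ω₂ y μ) →
    ∀ κ : Fin d, majIter d L j x ω₁ z κ = majIter d L j x ω₂ z κ
  | 0, x, ω₁, ω₂, z, h, κ => by simpa [majIter_zero, depRad, l1] using h z κ
  | j + 1, x, ω₁, ω₂, z, h, κ => by
      rw [majIter_succ, majIter_succ]
      refine majIter_congr_of_l1 d L j (prop1Radius d L x) z (fun y μ hy => ?_) κ
      exact stepMaj_congr_of_l1 L x y (fun y' μ' hy' => h y' μ' (l1_le_depRad_succ L j hy' hy)) μ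

omit [Fintype n] [DecidableEq n] in
/-- **THE FRAME FUNCTIONAL TOWER IS LOCAL**: `frameMaj d L j x ω z` reads `ω` only within ℓ¹-distance `depRad d L j` of `L^j•z`. [folklore] -/
theorem frameMaj_congr_of_l1 (d L : ℕ) : ∀ (j : ℕ) (x : ℝ) {ω₁ ω₂ : Site d → Fin d → ℝ} (z : Site d),
    (∀ (y : Site d) (μ : Fin d), l1 (y - ((L : ℤ) ^ j) • z) ≤ depRad d L j → ω₁ y μ = ω₂ y μ) →
    frameMaj d L j x ω₁ z = frameMaj d L j x ω₂ z
  | 0, _, _, _, _, _ => rfl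
  | j + 1, x, ω₁, ω₂, z, h => by
      rw [frameMaj_succ, frameMaj_succ]
      have h1 : frameMaj d L j (prop1Radius d L x) (stepMaj d L x ω₁) z = frameMaj d L j (prop1Radius d L x) (stepMaj d L x ω₂) z :=
        frameMaj_congr_of_l1 d L j (prop1Radius d L x) z fun y μ hy =>
          stepMaj_congr_of_l1 L x y (fun y' μ' hy' => h y' μ' (l1_le_depRad_succ L j hy' hy)) μ
      have h2 : treeStep L ω₁ ((((L ^ j : ℕ) : ℤ)) • z) = treeStep L ω₂ ((((L ^ j : ℕ) : ℤ)) • z) := by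
        refine treeStep_congr_of_l1 L _ fun y' μ' hy' => h y' μ' ?_
        have hz : l1 ((((L ^ j : ℕ) : ℤ)) • z - ((L : ℤ) ^ j) • z) ≤ depRad d L j := by push_cast; simp [l1]
        have := l1_le_depRad_succ L j hy' hz
        exact this
      rw [h1, h2]

/-- The weight patched outside the dependency ball by `‖Y‖` itself dominates `Y` everywhere. [folklore] -/
theorem dom_patch {Y : Site d → Fin d → Matrix n n ℂ} {ω : Site d → Fin d → ℝ} {q : Site d} {R : ℕ}
    (hdom : ∀ (y : Site d) (μ : Fin d), l1 (y - q) ≤ R → ‖Y y μ‖ ≤ ω y μ) (y : Site d) (μ : Fin d) :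
    ‖Y y μ‖ ≤ (fun y' μ' => if l1 (y' - q) ≤ R then ω y' μ' else ‖Y y' μ'‖) y μ := by
  simp only
  split
  · exact hdom y μ ‹_›
  · exact le_rfl

/-- **LOCAL-HYPOTHESIS VERSION OF FILE A's TOWER BOUND**: domination `‖Y(b)‖ ≤ ω(b)` is needed only on the bonds starting within
ℓ¹-distance `depRad d L (j+1)` of `L^{j+1}•z`. [folklore] -/
theorem norm_QbarIter_le_majIter_local [Nonempty n] {L : ℕ} (hL : 1 ≤ L) (j : ℕ)
    {W : Site d → Fin d → (Matrix n n ℂ)ˣ} {x : ℝ} (hWu : IsUnitaryCfg W) (hx : 0 ≤ x) (hs : LevelSmall d L j x) (hWx : SmallField W x)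
    {Y : Site d → Fin d → Matrix n n ℂ} {ω : Site d → Fin d → ℝ} (z : Site d)
    (hdom : ∀ (y : Site d) (μ : Fin d), l1 (y - ((L : ℤ) ^ (j + 1)) • z) ≤ depRad d L (j + 1) → ‖Y y μ‖ ≤ ω y μ) (κ : Fin d) :
    ‖QbarIter L (j + 1) W Y z κ‖ ≤ majIter d L (j + 1) x ω z κ := by
  have h := norm_QbarIter_le_majIter hL j hWu hx hs hWx (dom_patch hdom) z κ
  rwa [majIter_congr_of_l1 d L (j + 1) x z (ω₂ := ω) (fun y μ hy => if_pos hy) κ] at h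

/-- LOCAL-HYPOTHESIS VERSION of `norm_framePotW_le_frameMaj`. [folklore] -/
theorem norm_framePotW_le_frameMaj_local [Nonempty n] {L : ℕ} (hL : 1 ≤ L) (j : ℕ)
    {W : Site d → Fin d → (Matrix n n ℂ)ˣ} {x : ℝ} (hWu : IsUnitaryCfg W) (hx : 0 ≤ x) (hs : LevelSmall d L j x) (hWx : SmallField W x)
    {Y : Site d → Fin d → Matrix n n ℂ} {ω : Site d → Fin d → ℝ} (z : Site d)
    (hdom : ∀ (y : Site d) (μ : Fin d), l1 (y - ((L : ℤ) ^ (j + 1)) • z) ≤ depRad d L (j + 1) → ‖Y y μ‖ ≤ ω y μ) :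
    ‖framePotW L (j + 1) W Y z‖ ≤ frameMaj d L (j + 1) x ω z := by
  have h := norm_framePotW_le_frameMaj hL j hWu hx hs hWx (dom_patch hdom) z
  rwa [frameMaj_congr_of_l1 d L (j + 1) x z (ω₂ := ω) (fun y μ hy => if_pos hy)] at h

/-- **LOCAL-HYPOTHESIS VERSION OF THE `dirIter` DOMINATION**: in the class of §3, domination `‖Y(b)‖ ≤ ω(b)` is asked only on the bonds
starting within ℓ¹-distance `depRad d L (j+1)` of `L^{j+1}•z` or of `L^{j+1}•(z + e_κ)` (the box of record of Π-C-3d). [folklore] -/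
theorem norm_dirIter_le_majorant_local [Nonempty n] {L M : ℕ} [NeZero M] (hL : 1 ≤ L) (j : ℕ)
    {W : Site d → Fin d → (Matrix n n ℂ)ˣ} {x : ℝ} (hWu : IsUnitaryCfg W) (hWP : IsPeriodicCfg W ((tower L M (j + 1) : ℕ) : ℤ))
    (hx : 0 ≤ x) (hs : LevelSmall d L j x) (hWx : SmallField W x)
    {Y : Site d → Fin d → Matrix n n ℂ} (hY : IsSkewDir Y) (hYP : IsPeriodicDir Y ((tower L M (j + 1) : ℕ) : ℤ))
    {ω : Site d → Fin d → ℝ} (z : Site d) (κ : Fin d)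
    (hdom : ∀ (y : Site d) (μ : Fin d), (l1 (y - ((L : ℤ) ^ (j + 1)) • z) ≤ depRad d L (j + 1)
      ∨ l1 (y - ((L : ℤ) ^ (j + 1)) • (z + e κ)) ≤ depRad d L (j + 1)) → ‖Y y μ‖ ≤ ω y μ) :
    ‖dirIter L (j + 1) W Y z κ‖
      ≤ majIter d L (j + 1) x ω z κ + frameMaj d L (j + 1) x ω z + frameMaj d L (j + 1) x ω (z + e κ) := by
  rw [dirIter_eq_QbarIter_add_gaugeDir (M := M) hL j hWu hWP hx hs hWx hY hYP]
  have hVu : IsUnitaryCfg (cavgIter L (j + 1) W) := (cavgIter_unitary_small hL j hWu hx hs hWx).1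
  have h1 := norm_QbarIter_le_majIter_local hL j hWu hx hs hWx z (fun y μ hy => hdom y μ (Or.inl hy)) κ
  have h2 := norm_gaugeDir_le hVu (framePotW L (j + 1) W Y) z κ
  have h3 := norm_framePotW_le_frameMaj_local hL j hWu hx hs hWx z (fun y μ hy => hdom y μ (Or.inl hy))
  have h4 := norm_framePotW_le_frameMaj_local hL j hWu hx hs hWx (z + e κ) (fun y μ hy => hdom y μ (Or.inr hy))
  calc _ ≤ ‖QbarIter L (j + 1) W Y z κ‖ + ‖gaugeDir (cavgIter L (j + 1) W) (framePotW L (j + 1) W Y) z κ‖ := norm_add_le _ _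
    _ ≤ _ := by linarith

end

end Summit.QuantumFields.BalabanUV.T4Continuum.NE3DirIterMajorant
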